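import Summits.FinalStateConjecture.FinalStateConjecture.Theorems.EIHFluxBalanceInertialRecessionStubEndgameBasics

/-!
# Route EIHFluxBalance — crux `InertialRecession`, line `sublinear-is-free-clean-window-charges`:
# the impulse integral along a BALLISTIC path

Helper file for the crux `stmt-FinalStateConjecture-10166`
(`Summit.FinalStateConjecture.FinalStateConjecture.Theses.EIHFluxBalance.InertialRecession`), registered stub
`stub_cesaroEndgame` of `Cruxes/InertialRecession/Lines/sublinear-is-free-clean-window-charges.lean`.

THE ESTIMATE. If a real `C¹` coordinate `x` increases at speed `x′ ≥ W/2 > 0` on `[a, b]` then, for every `A > 0`,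
`∫_a^b (|x(u)| + A)^{-3/2} du ≤ 8/(W√A)` (`integral_ballistic_le`): the coordinate crosses each level once, so the time
integral is `≤ (2/W)·∫_ℝ (|y| + A)^{-3/2} dy = 8/(W√A)`. Proof by the fundamental theorem of calculus on the two sides of
the zero of `x` with the explicit primitives `∓(4/W)(±x + A)^{-1/2}`. This is the impulse a pair of holes in relative
ballistic motion at speed `W` and closest approach `≥ A` can receive under the window law `|ΔP| ≤ C∫d^{-3/2}`
(`d ≥ max(|x|, A) ≥ (|x| + A)/2`), and it tends to `0` as `A → ∞`: fast relative motion at large separation is ballistic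
forever (file `…StubEndgameBallistic`).

References: C. Marchal, D. Saari, J. Differential Equations 20 (1976) 150–186 (escape in the `N`-body problem).
-/

noncomputable section

set_option linter.dupNamespace false

open Filter Topology Set MeasureTheory intervalIntegral
open scoped Topology

namespace Summit.FinalStateConjecture.FinalStateConjecture.Theorems.SublinearIsFree.Endgame

/-- The primitive `u ↦ (x u + A)^{-1/2}` along a differentiable coordinate with `x + A > 0`:
derivative `−x′/(2 (x+A) √(x+A))`. [folklore] -/
theorem hasDerivAt_inv_sqrt_add {x : ℝ → ℝ} {x' u A : ℝ} (hx : HasDerivAt x x' u) (hpos : 0 < x u + A) :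
    HasDerivAt (fun v ↦ (√(x v + A))⁻¹) (-(x' / (2 * ((x u + A) * √(x u + A))))) u := by
  have h1 : HasDerivAt (fun v ↦ x v + A) x' u := hx.add_const A
  have h2 : HasDerivAt (fun v ↦ √(x v + A)) (x' / (2 * √(x u + A))) u := h1.sqrt hpos.ne'
  have hs : √(x u + A) ≠ 0 := (Real.sqrt_pos.mpr hpos).ne'
  have h3 := h2.inv hs
  have hsq : √(x u + A) ^ 2 = x u + A := Real.sq_sqrt hpos.le
  have hne : x u + A ≠ 0 := hpos.ne'
  refine h3.congr_deriv ?_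
  rw [hsq]
  field_simp

/-- The primitive `u ↦ (A − x u)^{-1/2}` along a differentiable coordinate with `A − x > 0`:
derivative `x′/(2 (A−x) √(A−x))`. [folklore] -/
theorem hasDerivAt_inv_sqrt_sub {x : ℝ → ℝ} {x' u A : ℝ} (hx : HasDerivAt x x' u) (hpos : 0 < A - x u) :
    HasDerivAt (fun v ↦ (√(A - x v))⁻¹) (x' / (2 * ((A - x u) * √(A - x u)))) u := by
  have h1 : HasDerivAt (fun v ↦ A - x v) (-x') u := by simpa using (hx.const_sub A)
  have h2 : HasDerivAt (fun v ↦ √(A - x v)) (-x' / (2 * √(A - x u))) u := h1.sqrt hpos.ne'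
  have hs : √(A - x u) ≠ 0 := (Real.sqrt_pos.mpr hpos).ne'
  have h3 := h2.inv hs
  have hsq : √(A - x u) ^ 2 = A - x u := Real.sq_sqrt hpos.le
  have hne : A - x u ≠ 0 := hpos.ne'
  refine h3.congr_deriv ?_
  rw [hsq]
  field_simp

/-- One-sided ballistic estimate, increasing NONNEGATIVE coordinate: if `x ≥ 0` on `[a, b]`, `x′ ≥ W/2 > 0`, then
`∫_a^b ((x+A)√(x+A))⁻¹ ≤ 4/(W√A)`. [folklore] -/
theorem integral_ballistic_nonneg_le {x x' : ℝ → ℝ} {a b W A : ℝ} (hab : a ≤ b) (hW : 0 < W) (hA : 0 < A)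
    (hx : ∀ u ∈ Icc a b, HasDerivAt x (x' u) u) (hx' : ContinuousOn x' (Icc a b))
    (hspeed : ∀ u ∈ Icc a b, W / 2 ≤ x' u) (hsign : ∀ u ∈ Icc a b, 0 ≤ x u) :
    ∫ u in a..b, ((x u + A) * √(x u + A))⁻¹ ≤ 4 / (W * √A) := by
  have hxcont : ContinuousOn x (Icc a b) := fun u hu ↦ (hx u hu).continuousAt.continuousWithinAt
  have hpos : ∀ u ∈ Icc a b, 0 < x u + A := fun u hu ↦ by linarith [hsign u hu]
  -- the primitive `Ψ(u) = −(4/W) (x u + A)^{-1/2}` and its derivative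
  set Ψ : ℝ → ℝ := fun u ↦ -(4 / W) * (√(x u + A))⁻¹ with hΨ
  set ψ : ℝ → ℝ := fun u ↦ -(4 / W) * (-(x' u / (2 * ((x u + A) * √(x u + A))))) with hψ
  have hderiv : ∀ u ∈ Icc a b, HasDerivAt Ψ (ψ u) u := fun u hu ↦
    (hasDerivAt_inv_sqrt_add (hx u hu) (hpos u hu)).const_mul _
  have hψcont : ContinuousOn ψ (Icc a b) := by
    have h1 : ContinuousOn (fun u ↦ (x u + A) * √(x u + A)) (Icc a b) :=
      (hxcont.add continuousOn_const).mul ((hxcont.add continuousOn_const).sqrt)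
    have h2 : ∀ u ∈ Icc a b, (2 * ((x u + A) * √(x u + A))) ≠ 0 := fun u hu ↦
      mul_ne_zero two_ne_zero (mul_pos (hpos u hu) (Real.sqrt_pos.mpr (hpos u hu))).ne'
    exact ((hx'.div (continuousOn_const.mul h1) h2).neg).const_smul (-(4 / W)) |>.congr fun u _ ↦ by
      simp [hψ, smul_eq_mul]
  -- pointwise domination of the integrand by `ψ`
  have hdom : ∀ u ∈ Icc a b, ((x u + A) * √(x u + A))⁻¹ ≤ ψ u := by
    intro u hu
    have hq : 0 < (x u + A) * √(x u + A) := mul_pos (hpos u hu) (Real.sqrt_pos.mpr (hpos u hu))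
    have : ψ u = (2 / W * x' u) * ((x u + A) * √(x u + A))⁻¹ := by
      simp only [hψ]; field_simp; ring
    rw [this]
    have h1 : 1 ≤ 2 / W * x' u := by
      rw [div_mul_eq_mul_div, le_div_iff₀ hW]; linarith [hspeed u hu]
    calc ((x u + A) * √(x u + A))⁻¹ = 1 * ((x u + A) * √(x u + A))⁻¹ := (one_mul _).symm
      _ ≤ (2 / W * x' u) * ((x u + A) * √(x u + A))⁻¹ :=
          mul_le_mul_of_nonneg_right h1 (inv_nonneg.mpr hq.le)
  have hfcont : ContinuousOn (fun u ↦ ((x u + A) * √(x u + A))⁻¹) (Icc a b) :=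
    ((hxcont.add continuousOn_const).mul ((hxcont.add continuousOn_const).sqrt)).inv₀ fun u hu ↦
      (mul_pos (hpos u hu) (Real.sqrt_pos.mpr (hpos u hu))).ne'
  calc ∫ u in a..b, ((x u + A) * √(x u + A))⁻¹ ≤ ∫ u in a..b, ψ u :=
        intervalIntegral.integral_mono_on hab (hfcont.intervalIntegrable_of_Icc hab)
          (hψcont.intervalIntegrable_of_Icc hab) hdom
    _ = Ψ b - Ψ a := by
        refine intervalIntegral.integral_eq_sub_of_hasDerivAt (fun u hu ↦ hderiv u ?_)
          (hψcont.intervalIntegrable_of_Icc hab)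
        rwa [uIcc_of_le hab] at hu
    _ ≤ 4 / (W * √A) := by
        simp only [hΨ]
        have ha : a ∈ Icc a b := left_mem_Icc.mpr hab
        have hb : b ∈ Icc a b := right_mem_Icc.mpr hab
        have h1 : 0 ≤ (√(x b + A))⁻¹ := inv_nonneg.mpr (Real.sqrt_nonneg _)
        have h2 : (√(x a + A))⁻¹ ≤ (√A)⁻¹ :=
          inv_anti₀ (Real.sqrt_pos.mpr hA) (Real.sqrt_le_sqrt (by linarith [hsign a ha]))
        have hW4 : 0 ≤ 4 / W := by positivity
        have : -(4 / W) * (√(x b + A))⁻¹ - -(4 / W) * (√(x a + A))⁻¹ =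
            4 / W * ((√(x a + A))⁻¹ - (√(x b + A))⁻¹) := by ring
        rw [this, div_mul_eq_div_div, div_eq_mul_inv (4 / W)]
        exact mul_le_mul_of_nonneg_left (by linarith) hW4

/-- One-sided ballistic estimate, increasing NONPOSITIVE coordinate: if `x ≤ 0` on `[a, b]`, `x′ ≥ W/2 > 0`, then
`∫_a^b ((A−x)√(A−x))⁻¹ ≤ 4/(W√A)`. [folklore] -/
theorem integral_ballistic_nonpos_le {x x' : ℝ → ℝ} {a b W A : ℝ} (hab : a ≤ b) (hW : 0 < W) (hA : 0 < A)
    (hx : ∀ u ∈ Icc a b, HasDerivAt x (x' u) u) (hx' : ContinuousOn x' (Icc a b))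
    (hspeed : ∀ u ∈ Icc a b, W / 2 ≤ x' u) (hsign : ∀ u ∈ Icc a b, x u ≤ 0) :
    ∫ u in a..b, ((A - x u) * √(A - x u))⁻¹ ≤ 4 / (W * √A) := by
  have hxcont : ContinuousOn x (Icc a b) := fun u hu ↦ (hx u hu).continuousAt.continuousWithinAt
  have hpos : ∀ u ∈ Icc a b, 0 < A - x u := fun u hu ↦ by linarith [hsign u hu]
  set Ψ : ℝ → ℝ := fun u ↦ (4 / W) * (√(A - x u))⁻¹ with hΨ
  set ψ : ℝ → ℝ := fun u ↦ (4 / W) * (x' u / (2 * ((A - x u) * √(A - x u)))) with hψ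
  have hderiv : ∀ u ∈ Icc a b, HasDerivAt Ψ (ψ u) u := fun u hu ↦
    (hasDerivAt_inv_sqrt_sub (hx u hu) (hpos u hu)).const_mul _
  have hψcont : ContinuousOn ψ (Icc a b) := by
    have h1 : ContinuousOn (fun u ↦ (A - x u) * √(A - x u)) (Icc a b) :=
      (continuousOn_const.sub hxcont).mul ((continuousOn_const.sub hxcont).sqrt)
    have h2 : ∀ u ∈ Icc a b, (2 * ((A - x u) * √(A - x u))) ≠ 0 := fun u hu ↦
      mul_ne_zero two_ne_zero (mul_pos (hpos u hu) (Real.sqrt_pos.mpr (hpos u hu))).ne'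
    exact ((hx'.div (continuousOn_const.mul h1) h2)).const_smul (4 / W) |>.congr fun u _ ↦ by
      simp [hψ, smul_eq_mul]
  have hdom : ∀ u ∈ Icc a b, ((A - x u) * √(A - x u))⁻¹ ≤ ψ u := by
    intro u hu
    have hq : 0 < (A - x u) * √(A - x u) := mul_pos (hpos u hu) (Real.sqrt_pos.mpr (hpos u hu))
    have : ψ u = (2 / W * x' u) * ((A - x u) * √(A - x u))⁻¹ := by
      simp only [hψ]; field_simp; ring
    rw [this]
    have h1 : 1 ≤ 2 / W * x' u := by
      rw [div_mul_eq_mul_div, le_div_iff₀ hW]; linarith [hspeed u hu]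
    calc ((A - x u) * √(A - x u))⁻¹ = 1 * ((A - x u) * √(A - x u))⁻¹ := (one_mul _).symm
      _ ≤ (2 / W * x' u) * ((A - x u) * √(A - x u))⁻¹ :=
          mul_le_mul_of_nonneg_right h1 (inv_nonneg.mpr hq.le)
  have hfcont : ContinuousOn (fun u ↦ ((A - x u) * √(A - x u))⁻¹) (Icc a b) :=
    ((continuousOn_const.sub hxcont).mul ((continuousOn_const.sub hxcont).sqrt)).inv₀ fun u hu ↦
      (mul_pos (hpos u hu) (Real.sqrt_pos.mpr (hpos u hu))).ne'
  calc ∫ u in a..b, ((A - x u) * √(A - x u))⁻¹ ≤ ∫ u in a..b, ψ u :=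
        intervalIntegral.integral_mono_on hab (hfcont.intervalIntegrable_of_Icc hab)
          (hψcont.intervalIntegrable_of_Icc hab) hdom
    _ = Ψ b - Ψ a := by
        refine intervalIntegral.integral_eq_sub_of_hasDerivAt (fun u hu ↦ hderiv u ?_)
          (hψcont.intervalIntegrable_of_Icc hab)
        rwa [uIcc_of_le hab] at hu
    _ ≤ 4 / (W * √A) := by
        simp only [hΨ]
        have ha : a ∈ Icc a b := left_mem_Icc.mpr hab
        have hb : b ∈ Icc a b := right_mem_Icc.mpr hab
        have h1 : 0 ≤ (√(A - x a))⁻¹ := inv_nonneg.mpr (Real.sqrt_nonneg _)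
        have h2 : (√(A - x b))⁻¹ ≤ (√A)⁻¹ :=
          inv_anti₀ (Real.sqrt_pos.mpr hA) (Real.sqrt_le_sqrt (by linarith [hsign b hb]))
        have hW4 : 0 ≤ 4 / W := by positivity
        have : 4 / W * (√(A - x b))⁻¹ - 4 / W * (√(A - x a))⁻¹ =
            4 / W * ((√(A - x b))⁻¹ - (√(A - x a))⁻¹) := by ring
        rw [this, div_mul_eq_div_div, div_eq_mul_inv (4 / W)]
        exact mul_le_mul_of_nonneg_left (by linarith) hW4

/-- THE BALLISTIC ESTIMATE: for a `C¹` coordinate increasing at speed `x′ ≥ W/2 > 0` on `[a, b]` and `A > 0`,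
`∫_a^b ((|x|+A)√(|x|+A))⁻¹ ≤ 8/(W√A)` (split at the zero of `x`). [folklore] -/
theorem integral_ballistic_le {x x' : ℝ → ℝ} {a b W A : ℝ} (hab : a ≤ b) (hW : 0 < W) (hA : 0 < A)
    (hx : ∀ u ∈ Icc a b, HasDerivAt x (x' u) u) (hx' : ContinuousOn x' (Icc a b))
    (hspeed : ∀ u ∈ Icc a b, W / 2 ≤ x' u) :
    ∫ u in a..b, ((|x u| + A) * √(|x u| + A))⁻¹ ≤ 8 / (W * √A) := by
  have hxcont : ContinuousOn x (Icc a b) := fun u hu ↦ (hx u hu).continuousAt.continuousWithinAt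
  have h4 : 0 ≤ 4 / (W * √A) := by positivity
  -- `x` is monotone on `[a, b]`
  have hmono : MonotoneOn x (Icc a b) := by
    refine monotoneOn_of_deriv_nonneg (convex_Icc a b) hxcont (fun u hu ↦ ?_) fun u hu ↦ ?_
    · exact (hx u (interior_subset hu)).differentiableAt.differentiableWithinAt
    · rw [(hx u (interior_subset hu)).deriv]
      linarith [hspeed u (interior_subset hu)]
  have h8 : 8 / (W * √A) = 4 / (W * √A) + 4 / (W * √A) := by ring
  -- the integrand is continuous
  have hfcont : ∀ {a' b' : ℝ}, Icc a' b' ⊆ Icc a b →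
      ContinuousOn (fun u ↦ ((|x u| + A) * √(|x u| + A))⁻¹) (Icc a' b') := by
    intro a' b' hsub
    have hc : ContinuousOn (fun u ↦ |x u| + A) (Icc a' b') := (hxcont.mono hsub).abs.add continuousOn_const
    refine (hc.mul hc.sqrt).inv₀ fun u _ ↦ ?_
    have : 0 < |x u| + A := by positivity
    exact (mul_pos this (Real.sqrt_pos.mpr this)).ne'
  -- the three cases
  by_cases ha0 : 0 ≤ x a
  · -- nonnegative throughout
    have hsign : ∀ u ∈ Icc a b, 0 ≤ x u := fun u hu ↦
      ha0.trans (hmono (left_mem_Icc.mpr hab) hu hu.1)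
    calc ∫ u in a..b, ((|x u| + A) * √(|x u| + A))⁻¹ = ∫ u in a..b, ((x u + A) * √(x u + A))⁻¹ := by
          refine integral_congr fun u hu ↦ ?_
          rw [uIcc_of_le hab] at hu
          simp only [abs_of_nonneg (hsign u hu)]
      _ ≤ 4 / (W * √A) := integral_ballistic_nonneg_le hab hW hA hx hx' hspeed hsign
      _ ≤ 8 / (W * √A) := by linarith
  by_cases hb0 : x b ≤ 0
  · -- nonpositive throughout
    have hsign : ∀ u ∈ Icc a b, x u ≤ 0 := fun u hu ↦
      (hmono hu (right_mem_Icc.mpr hab) hu.2).trans hb0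
    calc ∫ u in a..b, ((|x u| + A) * √(|x u| + A))⁻¹ = ∫ u in a..b, ((A - x u) * √(A - x u))⁻¹ := by
          refine integral_congr fun u hu ↦ ?_
          rw [uIcc_of_le hab] at hu
          simp only [abs_of_nonpos (hsign u hu)]
          ring_nf
      _ ≤ 4 / (W * √A) := integral_ballistic_nonpos_le hab hW hA hx hx' hspeed hsign
      _ ≤ 8 / (W * √A) := by linarith
  -- sign change: split at a zero `c ∈ [a, b]` of `x`
  push Not at ha0 hb0
  obtain ⟨c, hc, hxc⟩ : ∃ c ∈ Icc a b, x c = 0 :=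
    intermediate_value_Icc hab hxcont ⟨ha0.le, hb0.le⟩
  have hac : a ≤ c := hc.1
  have hcb : c ≤ b := hc.2
  have hsub1 : Icc a c ⊆ Icc a b := Icc_subset_Icc le_rfl hcb
  have hsub2 : Icc c b ⊆ Icc a b := Icc_subset_Icc hac le_rfl
  have hneg : ∀ u ∈ Icc a c, x u ≤ 0 := fun u hu ↦ by
    have := hmono (hsub1 hu) hc hu.2; rwa [hxc] at this
  have hposc : ∀ u ∈ Icc c b, 0 ≤ x u := fun u hu ↦ by
    have := hmono hc (hsub2 hu) hu.1; rwa [hxc] at this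
  have hint1 : IntervalIntegrable (fun u ↦ ((|x u| + A) * √(|x u| + A))⁻¹) volume a c :=
    (hfcont hsub1).intervalIntegrable_of_Icc hac
  have hint2 : IntervalIntegrable (fun u ↦ ((|x u| + A) * √(|x u| + A))⁻¹) volume c b :=
    (hfcont hsub2).intervalIntegrable_of_Icc hcb
  rw [← intervalIntegral.integral_add_adjacent_intervals hint1 hint2]
  have e1 : ∫ u in a..c, ((|x u| + A) * √(|x u| + A))⁻¹ ≤ 4 / (W * √A) := by
    calc ∫ u in a..c, ((|x u| + A) * √(|x u| + A))⁻¹ = ∫ u in a..c, ((A - x u) * √(A - x u))⁻¹ := by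
          refine integral_congr fun u hu ↦ ?_
          rw [uIcc_of_le hac] at hu
          simp only [abs_of_nonpos (hneg u hu)]
          ring_nf
      _ ≤ 4 / (W * √A) := integral_ballistic_nonpos_le hac hW hA (fun u hu ↦ hx u (hsub1 hu))
          (hx'.mono hsub1) (fun u hu ↦ hspeed u (hsub1 hu)) hneg
  have e2 : ∫ u in c..b, ((|x u| + A) * √(|x u| + A))⁻¹ ≤ 4 / (W * √A) := by
    calc ∫ u in c..b, ((|x u| + A) * √(|x u| + A))⁻¹ = ∫ u in c..b, ((x u + A) * √(x u + A))⁻¹ := by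
          refine integral_congr fun u hu ↦ ?_
          rw [uIcc_of_le hcb] at hu
          simp only [abs_of_nonneg (hposc u hu)]
      _ ≤ 4 / (W * √A) := integral_ballistic_nonneg_le hcb hW hA (fun u hu ↦ hx u (hsub2 hu))
          (hx'.mono hsub2) (fun u hu ↦ hspeed u (hsub2 hu)) hposc
  linarith

/-- Registered helper form (verbatim signature) of `integral_ballistic_le`. [folklore] -/
theorem endgame_integral_ballistic_le : ∀ (x x' : ℝ → ℝ) (a b W A : ℝ), a ≤ b → 0 < W → 0 < A → (∀ u ∈ Set.Icc a b, HasDerivAt x (x' u) u) → ContinuousOn x' (Set.Icc a b) → (∀ u ∈ Set.Icc a b, W / 2 ≤ x' u) → ∫ u in a..b, ((|x u| + A) * √(|x u| + A))⁻¹ ≤ 8 / (W * √A) :=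
  fun _ _ _ _ _ _ hab hW hA hx hx' hspeed ↦ integral_ballistic_le hab hW hA hx hx' hspeed

end Summit.FinalStateConjecture.FinalStateConjecture.Theorems.SublinearIsFree.Endgame

end
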